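import Summits.Ventures.PercRepro.RankLevelSetFrameQ
import Summits.Ventures.PercRepro.RankLevelSetM
import Summits.Ventures.PercRepro.RankLevelSetG

/-!
# PercRepro — C-025: the wrapper with Theorems M and G′ folded in — the core has corank `≥ q + 2` and a short circuit (night-1, gen 0)

`rls_succ_all` (`RankLevelSetFrameQ`) reduces `C025` at level `q + 1` to the simple, coloop-free, rank-`p` core in which
every element admits an `e`-free partition. Three more pieces of that core are theorems of the tree: `|E| < p + q + 1`
has `U = ∅` (`RLS_of_ncard_lt`); `|E| = p + q + 1` is p3's Theorem M `c025_of_ncard_eq` (`RLS_of_ncard_eq`, the tight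
layer); and «every circuit has `≥ q + 3` elements» is p3's Theorem G′ `c025_of_circuits` (`RLS_of_circuits`).
`rls_succ_all_M` folds them in: the core hypothesis may assume `p + (q + 1) < |E|` (CORANK `|E| − p ≥ q + 2`, the first
layer on which the single-element induction does not close in general — night-1's census, `proofs/NIGHT-1-C025-induction.md`
§5–§6) and a circuit with at most `q + 2` elements. `c025_three_of_core_M` is the `q = 3` instance. Axioms: standard.
-/

open scoped Matroid

namespace PercRepro

namespace ThmN

variable {α : Type}

/-- `RLS M p q` holds when `|E| < p + q`: a member of `U(p, q)` would need `p ≤ |A|` and `q ≤ |E ∖ A|`. -/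
theorem RLS_of_ncard_lt (M : Matroid α) [M.Finite] {p q : ℕ} (h : M.E.ncard < p + q) : RLS M p q := by
  unfold RLS
  have hempty : {A : Set α | A ⊆ M.E ∧ M.eRk A = (p : ℕ∞) ∧ M.eRk (M.E \ A) = (q : ℕ∞)} = ∅ := by
    rw [Set.eq_empty_iff_forall_notMem]
    rintro A ⟨hA, hp, hq⟩
    have hAfin : A.Finite := M.ground_finite.subset hA
    have h1 : (p : ℕ∞) ≤ A.ncard := by
      rw [← hp, hAfin.cast_ncard_eq]; exact M.eRk_le_encard A
    have h2 : (q : ℕ∞) ≤ (M.E \ A).ncard := by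
      rw [← hq, (M.ground_finite.subset Set.sdiff_subset).cast_ncard_eq]; exact M.eRk_le_encard _
    have h3 : A.ncard + (M.E \ A).ncard = M.E.ncard := by
      rw [← Set.ncard_union_eq Set.disjoint_sdiff_right hAfin (M.ground_finite.subset Set.sdiff_subset),
        Set.union_sdiff_cancel hA]
    have h1' : p ≤ A.ncard := by exact_mod_cast h1
    have h2' : q ≤ (M.E \ A).ncard := by exact_mod_cast h2
    omega
  rw [hempty, Set.ncard_empty, Nat.cast_zero, mul_zero]
  positivity

/-- **Theorem M** in `RLS` form: `|E| = p + q` gives `RLS M p q` (p3's `c025_of_ncard_eq`). -/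
theorem RLS_of_ncard_eq (M : Matroid α) [M.Finite] {p q : ℕ} (h : M.E.ncard = p + q) : RLS M p q :=
  c025_of_ncard_eq M p q h

/-- **Theorem G′** in `RLS` form: every circuit of size `≥ q + 2` gives `RLS M p q` (p3's `c025_of_circuits`). -/
theorem RLS_of_circuits (M : Matroid α) [M.Finite] {p q : ℕ}
    (h : ∀ C, M.IsCircuit C → ((q + 2 : ℕ) : ℕ∞) ≤ C.encard) : RLS M p q :=
  c025_of_circuits p q h

/-- **The wrapper at level `q + 1` with Theorems M and G′ folded in**: the core may assume, besides simplicity, rank `p`,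
no coloops and an `e`-free partition for every element, that `p + (q + 1) < |E|` (corank `≥ q + 2`) and that some circuit
has fewer than `q + 3` elements. -/
theorem rls_succ_all_M (q : ℕ)
    (hprev : ∀ (M : Matroid α) [M.Finite] (p : ℕ), q + 2 ≤ p → RLS M p q)
    (hcore : ∀ (M : Matroid α) [M.Finite] (p : ℕ), q + 3 ≤ p →
      (∀ e ∈ M.E, ∀ f ∈ M.E, e ≠ f → M.eRk {e, f} = 2) → M.eRank = (p : ℕ∞) →
      (∀ e, ¬ M.IsColoop e) →
      (∀ e ∈ M.E, ∃ A ⊆ M.E \ {e}, e ∉ M.closure A ∧ e ∉ M.closure ((M.E \ {e}) \ A)) →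
      p + (q + 1) < M.E.ncard → (∃ C, M.IsCircuit C ∧ C.encard < ((q + 3 : ℕ) : ℕ∞)) →
      RLS M p (q + 1)) :
    ∀ (M : Matroid α) [M.Finite] (p : ℕ), q + 3 ≤ p → RLS M p (q + 1) :=
  rls_succ_all q hprev (fun M _ p hp hs hR hcol hfree => by
    rcases lt_trichotomy M.E.ncard (p + (q + 1)) with hlt | heq | hgt
    · exact RLS_of_ncard_lt M hlt
    · exact RLS_of_ncard_eq M heq
    · by_cases hG : ∀ C, M.IsCircuit C → ((q + 1 + 2 : ℕ) : ℕ∞) ≤ C.encard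
      · exact RLS_of_circuits M hG
      · push Not at hG
        obtain ⟨C, hC, hlt'⟩ := hG
        exact hcore M p hp hs hR hcol hfree hgt ⟨C, hC, by
          rw [show q + 3 = q + 1 + 2 by ring]; exact hlt'⟩)

/-- **`C025` at `q = 3` from the corank-`≥ 5` core with a short circuit**: if every simple coloop-free matroid of rank
`p ≥ 5` on more than `p + 3` elements, with a circuit of at most `4` elements, in which every element admits an
`e`-free partition satisfies the body at `(p, 3)`, then every finite matroid does, for every `p ≥ 5`. -/
theorem c025_three_of_core_M
    (hcore : ∀ (M : Matroid α) [M.Finite] (p : ℕ), 5 ≤ p →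
      (∀ e ∈ M.E, ∀ f ∈ M.E, e ≠ f → M.eRk {e, f} = 2) → M.eRank = (p : ℕ∞) →
      (∀ e, ¬ M.IsColoop e) →
      (∀ e ∈ M.E, ∃ A ⊆ M.E \ {e}, e ∉ M.closure A ∧ e ∉ M.closure ((M.E \ {e}) \ A)) →
      p + 3 < M.E.ncard → (∃ C, M.IsCircuit C ∧ C.encard < ((2 + 3 : ℕ) : ℕ∞)) → RLS M p 3) :
    ∀ (M : Matroid α) [M.Finite] (p : ℕ), 5 ≤ p → RLS M p 3 :=
  rls_succ_all_M 2 (fun M _ p hp => c025_two_all M p hp) hcore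

end ThmN

end PercRepro
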